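import Summits.FinalStateConjecture.FinalStateConjecture.Theses.StarvedNecks
import Summits.FinalStateConjecture.FinalStateConjecture.Theorems.StarvedNecksNecksCertifyReductionZero
import Summits.FinalStateConjecture.FinalStateConjecture.Theorems.NecksCertify.Negative.NecksCertifyFalseOfComovingPairWitness

/-!
# Route StarvedNecks — the superseded edge `NecksCertify` (stmt-13549) against the live crux `NecksCertifyR` (stmt-17574)

Prover seat `prover-pitem-stmt-FinalStateConjecture-13549-0`, 2026-08-16.  Since route rev 3 the repaired crux
`Theses.StarvedNecks.NecksCertifyR` (= `NecksCertify` with ONE inserted antecedent: pairwise distinct asymptotic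
four-velocities `Λᵢ∂₀ ≠ Λⱼ∂₀` of the input's holes) is a decl of the route file.  This file banks, against that
ROUTE DECL (so far only the crux workfile `Cruxes/NecksCertify/Restated.lean` had them, which Theorems files
cannot import), the two relations the route text relies on:

* `necksCertifyR_of_necksCertify` — the rev-1 item implies the repaired one (drop the extra antecedent); with
  the landed `…Negative.comovingPairWitness_iff_not_necksCertify` (p121147) this locates the whole difference
  between the two items in the comoving case: `necksCertify_iff_necksCertifyR_and_not_comovingPairWitness`.
* `necksCertifyR_of_neckLedgerAnalysisPos` — after the repair the crux is ONE registered physics stub: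
  `NecksCertifyR` follows from the statement of `stub_neckLedgerAnalysisPos` of the v5 skeleton
  (`Cruxes/NecksCertify/Lines/two_cap_focusing_ledger.lean`; bundles inlined verbatim), by the landed reduction
  `…Theorems.NecksCertifyTwoCap.ReductionZero.necksCertify_repaired_of_neckLedgerAnalysisPos` (p116546), whose
  conclusion is token-identical to the body of the route decl.

No definitions, no named facts, no `sorry`; pure logic over landed files.  References: route file
`Theses/StarvedNecks.lean` rev 3 (items stmt-FinalStateConjecture-13549, -17574); DHRT arXiv:2104.08222 §1
(the multi-black-hole final-state picture); Dafermos–Luk arXiv:1710.01722 §1.2.1.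
-/

noncomputable section

open scoped Manifold ContDiff Topology ENNReal
open Filter Set MeasureTheory Topology Literature.Geometry.Lorentzian

namespace Summit.FinalStateConjecture.FinalStateConjecture.Theorems.NecksCertifyRRelations

set_option linter.dupNamespace false -- `FinalStateConjecture.FinalStateConjecture` is the D-0017 summit/problem layout

/-- **The rev-1 item implies the repaired crux**: `NecksCertify → NecksCertifyR` (the repaired statement has
one more antecedent — pairwise distinct asymptotic four-velocities of the input — and the `let`-bound bundles
`Hc`, `Hf`, `Sm` of the two route decls are token-identical, so the instance is literally the old statement
with the extra hypothesis discarded). [folklore] -/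
theorem necksCertifyR_of_necksCertify (h : Theses.StarvedNecks.NecksCertify) :
    Theses.StarvedNecks.NecksCertifyR := by
  intro X _ _ _ _ D hD 𝒟 h𝒟 O d R₀ hO hc hf _
  exact h X D hD 𝒟 h𝒟 O d R₀ hO hc hf

/-- **What the rev-1 item asks beyond the repaired crux is exactly the comoving case**:
`NecksCertify ↔ NecksCertifyR ∧ ¬ ComovingPairWitness`, where `ComovingPairWitness` (landed,
`…Theorems.NecksCertify.Negative`, p121147) is an honest `C⁴` two-hole input none of whose honest-core seamed
`C²` re-chartings has pairwise distinct labels — by `comovingPairWitness_iff_not_necksCertify` the second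
conjunct alone is already equivalent to the rev-1 item, so the equivalence records that the repair loses
nothing but that case. [folklore] -/
theorem necksCertify_iff_necksCertifyR_and_not_comovingPairWitness :
    Theses.StarvedNecks.NecksCertify ↔
      Theses.StarvedNecks.NecksCertifyR ∧ ¬ NecksCertify.Negative.ComovingPairWitness :=
  ⟨fun h ↦ ⟨necksCertifyR_of_necksCertify h, NecksCertify.Negative.not_comovingPairWitness_of_necksCertify h⟩,
    fun h ↦ by
      by_contra hS
      exact h.2 (NecksCertify.Negative.comovingPairWitness_of_not_necksCertify hS)⟩

set_option maxHeartbeats 800000 in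
/-- **After the repair the crux is ONE stub** (Theorems-side copy of `Cruxes/NecksCertify/Restated.lean`
`necksCertifyR_of_neckLedgerAnalysisPos`, now concluding the ROUTE decl): `Theses.StarvedNecks.NecksCertifyR`
from the statement of the registered physics stub `stub_neckLedgerAnalysisPos` of the v5 skeleton (hypothesis =
that stub's statement with the bundles `HonestCore`, `HonestFar`, `NeckCertificate`, `HuygensNeckLemma`,
`KirchhoffFormula` inlined, verbatim the hypothesis of the landed reduction
`…ReductionZero.necksCertify_repaired_of_neckLedgerAnalysisPos`, p116546, whose conclusion is the body of the
route decl). [folklore] -/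
theorem necksCertifyR_of_neckLedgerAnalysisPos :
    let HonestCore := fun (𝓢 : Spacetime.{0} 4) (O : Set 𝓢.carrier) (k : ℕ)
        (d : FinalStateDecomposition 𝓢 O k) (R₀ : ℝ) ↦
      let B := d.background; let t := fun i ↦ (B i).time; let r := fun i ↦ (B i).radius; let Ψ := d.chart;
      (∀ i, Kerr.IsSubextremal (d.mass i) (d.spin i) ∧ 100 * d.mass i ≤ R₀ ∧ 0 < ((d.motion i).1 : E4 ≃L[ℝ] E4) (E4.basisVector 0) 0) ∧
        (∀ i (ϱ τ₂ : ℝ), R₀ ≤ ϱ → d.τ₀ < τ₂ → Ψ i '' {x | d.τ₀ < t i x.1 ∧ t i x.1 < τ₂ ∧ r i x.1 < ϱ} ⊆ 𝓢.metric.causalPast 𝓢.timeOrientation (Ψ i '' (B i).truncTimeSlab ϱ τ₂)) ∧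
        (∀ i (τ' : ℝ) (ϱ : ℝ → ℝ), Continuous ϱ → d.τ₀ < τ' → let A := Ψ i '' {x | τ' ≤ t i x.1 ∧ r i x.1 ≤ ϱ (t i x.1)}; closure A ∩ O ⊆ A) ∧
        (∀ y : d.flatDomain, d.τ₀ < y.1 0 → 𝓢.timeOrientation.IsFutureDirected (mfderiv 𝓘(ℝ, E4) (𝓡 4) d.flatChart y (E4.basisVector 0)))
    let HonestFar := fun (𝓢 : Spacetime.{0} 4) (O : Set 𝓢.carrier) (k : ℕ)
        (d : FinalStateDecomposition 𝓢 O k) (R₀ : ℝ) ↦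
      let B := d.background; let t := fun i ↦ (B i).time; let r := fun i ↦ (B i).radius; let Φ := d.flatChart;
      (∀ τ₂ : ℝ, d.τ₀ < τ₂ → Φ '' {y | d.τ₀ < y.1 0 ∧ y.1 0 < τ₂} ⊆ 𝓢.metric.causalPast 𝓢.timeOrientation (Φ '' (Minkowski.backgroundOn d.flatDomain).timeSlab τ₂)) ∧
        (∀ τ' : ℝ, d.τ₀ < τ' → closure (Φ '' {y | τ' ≤ y.1 0 ∧ ∀ i, d.excision i (y.1 0) + 1 ≤ r i y.1}) ⊆ Φ '' {y | τ' ≤ y.1 0}) ∧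
        (∀ i, ∃ T : ℝ, supCkENorm (Subtype.val '' {x : (B i).domain | T ≤ t i x.1 ∧ R₀ ≤ r i x.1 ∧ ∀ j, j ≠ i → r i x.1 ≤ r j x.1}) 0 (𝓢.deviationExtend (B i) (d.chart i)) ≤ ENNReal.ofReal (1 / (10 * ‖(((d.motion i).1 : E4 ≃L[ℝ] E4) : E4 →L[ℝ] E4)‖ ^ 2)))
    let NeckCertificate := fun (𝓢 : Spacetime.{0} 4) (O : Set 𝓢.carrier) (d : FinalStateDecomposition 𝓢 O 4)
        (R₀ : ℝ) ↦
      let B := d.background; let t := fun i ↦ (B i).time; let r := fun i ↦ (B i).radius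
      let Λ := fun i ↦ ((d.motion i).1 : E4 ≃L[ℝ] E4); let Φ := d.flatChart; let Ψ := d.chart
      let ρ := d.excision
      ∃ (R₁ τ₁ : ℝ) (ρa Rc : Fin d.N → ℝ → ℝ) (Ψa : ∀ i, (B i).domain → 𝓢.carrier),
        R₀ ≤ R₁ ∧ d.τ₀ ≤ τ₁ ∧
        (∀ i, Monotone (ρa i) ∧ Continuous (ρa i) ∧ Tendsto (fun s ↦ ρa i s / s) atTop (𝓝 0) ∧
          Tendsto (ρa i) atTop atTop ∧ ∀ s, R₁ + 1 ≤ ρa i s ∧ (τ₁ ≤ s → ρ i s + 1 ≤ ρa i s)) ∧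
        (∀ i, Monotone (Rc i) ∧ Continuous (Rc i) ∧ Tendsto (fun s ↦ Rc i s / s) atTop (𝓝 0) ∧
          Tendsto (Rc i) atTop atTop ∧ ∀ s, R₁ + 4 ≤ Rc i s) ∧
        (∀ j (y : E4), τ₁ ≤ y 0 → r j y ≤ 9 * ρa j (y 0) → r j y + 3 ≤ Rc j (t j y)) ∧
        (∀ i, let U : Set (B i).domain := {x | τ₁ < t i x.1 ∧ r i x.1 < Rc i (t i x.1) + 2}
          ContMDiffOn 𝓘(ℝ, E4) (𝓡 4) ∞ (Ψa i) U ∧ IsOpenEmbedding (U.restrict (Ψa i)) ∧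
            Ψa i '' U ⊆ d.charted) ∧
        (∀ i (x : (B i).domain), r i x.1 ≤ R₁ + 1 → Ψa i x = Ψ i x) ∧
        (∀ i (y : E4) (hy : y ∈ (B i).domain), τ₁ ≤ y 0 → 4 * ρa i (y 0) ≤ r i y →
          r i y ≤ Rc i (t i y) + 2 → ∃ hy' : y ∈ d.flatDomain, Ψa i ⟨y, hy⟩ = Φ ⟨y, hy'⟩) ∧
        (∀ i, Tendsto (fun τ ↦ 𝓢.truncDeviationCk (B i) (Ψa i) 2 (Rc i τ) τ) atTop (𝓝 0)) ∧
        (∀ i, supCkENorm (Subtype.val '' {x : (B i).domain | τ₁ ≤ t i x.1 ∧ R₁ ≤ r i x.1 ∧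
            r i x.1 ≤ Rc i (t i x.1) + 2}) 0 (𝓢.deviationExtend (B i) (Ψa i)) ≤
          ENNReal.ofReal (1 / (10 * ‖(Λ i : E4 →L[ℝ] E4)‖ ^ 2))) ∧
        (∀ i (x : (B i).domain), τ₁ ≤ t i x.1 → R₁ ≤ r i x.1 → r i x.1 ≤ Rc i (t i x.1) + 2 →
          𝓢.timeOrientation.IsFutureDirected
            (mfderiv 𝓘(ℝ, E4) (𝓡 4) (Ψa i) x ((Λ i) (E4.basisVector 0)))) ∧
        (∀ i j, i ≠ j → Disjoint (Ψa i '' {x | τ₁ < t i x.1 ∧ r i x.1 < Rc i (t i x.1) + 2})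
          (Ψa j '' {x | τ₁ < t j x.1 ∧ r j x.1 < Rc j (t j x.1) + 2})) ∧
        (∀ i (τ' : ℝ) (ϱ : ℝ → ℝ), Continuous ϱ → τ₁ < τ' → (∀ s, ϱ s < Rc i s + 2) →
          closure (Ψa i '' {x | τ' ≤ t i x.1 ∧ r i x.1 ≤ ϱ (t i x.1)}) ∩ O ⊆
            Ψa i '' {x | τ' ≤ t i x.1 ∧ r i x.1 ≤ ϱ (t i x.1)}) ∧
        (∀ (T : ℝ) (Th : Fin d.N → ℝ), τ₁ < T → (∀ j, τ₁ < Th j) →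
          (∀ j (y : E4), T < y 0 → r j y ≤ Rc j (t j y) + 2 → Th j < t j y) →
          O \ (Φ '' {y | T < y.1 0 ∧ ∀ j, 5 * ρa j (y.1 0) < r j y.1} ∪
              ⋃ j, Ψa j '' {x | Th j < t j x.1 ∧ r j x.1 < Rc j (t j x.1) + 2}) ⊆
            𝓢.metric.causalPast 𝓢.timeOrientation
              (Φ '' {y | y.1 0 = T ∧ ∀ j, 5 * ρa j (y.1 0) < r j y.1} ∪
                ⋃ j, Ψa j '' {x | t j x.1 = Th j ∧ r j x.1 < Rc j (t j x.1) + 2}))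
    let HuygensNeckLemma : Prop :=
      ∀ (φ : E4 → ℝ) (T R₀ : ℝ) (ρ : ℝ → ℝ), 0 < R₀ → ContDiff ℝ ∞ φ →
        (∀ y : E4, T ≤ y 0 → R₀ ≤ E4.spatialNorm y →
          KerrSchild.waveOperator (fun _ ↦ Kerr.etaComp) φ y = 0) →
        Monotone ρ → (∀ s, R₀ + 2 ≤ ρ s) → Tendsto (fun s ↦ ρ s / s) atTop (𝓝 0) →
        Tendsto (fun s ↦ supCkENorm {y : E4 | y 0 = s ∧ R₀ ≤ E4.spatialNorm y ∧ E4.spatialNorm y ≤ R₀ + 1} 3 φ)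
          atTop (𝓝 0) →
        Tendsto (fun s ↦ supCkENorm {y : E4 | y 0 = s ∧ ρ s ≤ E4.spatialNorm y} 2 φ) atTop (𝓝 0) →
        (∀ e : ℝ, 0 < e → ∃ S : ℝ, ∀ (t : ℝ) (x : E3), S ≤ t → R₀ + 1 ≤ ‖x‖ → ‖x‖ ≤ ρ t →
          ∫ z in {z : E3 | 4 * ρ t ≤ ‖z - x‖ ∧ ‖z - x‖ ≤ 5 * ρ t},
              (∑ m ∈ Finset.Icc 1 3, ‖iteratedFDeriv ℝ m φ (E4.ofTimeSpace (t - ‖z - x‖) z)‖ ^ 2)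
            ≤ e * ρ t) →
        Tendsto (fun s ↦ supCkENorm
          {y : E4 | y 0 = s ∧ R₀ + 1 ≤ E4.spatialNorm y ∧ E4.spatialNorm y ≤ ρ s} 2 φ) atTop (𝓝 0)
    let KirchhoffFormula : Prop :=
      ∀ (ψ : E4 → ℝ), ContDiff ℝ ∞ ψ → ∀ (t : ℝ) (x : E3) (σ : ℝ), 0 < σ →
        ψ (E4.ofTimeSpace t x) =
          (((volume : Measure E3).toSphere univ).toReal)⁻¹ *
              ∫ (w : Metric.sphere (0 : E3) 1), ψ (E4.ofTimeSpace (t - σ) (x + σ • (w : E3)))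
                ∂((volume : Measure E3).toSphere)
          + σ * ((((volume : Measure E3).toSphere univ).toReal)⁻¹ *
              ∫ (w : Metric.sphere (0 : E3) 1),
                fderiv ℝ ψ (E4.ofTimeSpace (t - σ) (x + σ • (w : E3))) (E4.ofTimeSpace 1 (w : E3))
                ∂((volume : Measure E3).toSphere))
          - ∫ s in (0 : ℝ)..σ, s * ((((volume : Measure E3).toSphere univ).toReal)⁻¹ *
              ∫ (w : Metric.sphere (0 : E3) 1),
                KerrSchild.waveOperator (fun _ ↦ Kerr.etaComp) ψ (E4.ofTimeSpace (t - s) (x + s • (w : E3)))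
                ∂((volume : Measure E3).toSphere))
    (HuygensNeckLemma → KirchhoffFormula →
      ∀ (X : Type) [TopologicalSpace X] [ChartedSpace E3 X] [IsManifold (𝓡 3) ∞ X] [ConnectedSpace X]
        (D : InitialDataSet (𝓡 3) X), D ∈ admissibleVacuumData X →
        ∀ 𝒟 : VacuumCauchyDevelopment D, 𝒟.IsMaximal →
        ∀ (O : Set 𝒟.carrier) (d : FinalStateDecomposition 𝒟.toSpacetime O 4) (R₀ : ℝ),
          O = exteriorOf 𝒟.toCauchyDevelopment d.charted →
          HonestCore 𝒟.toSpacetime O 4 d R₀ → HonestFar 𝒟.toSpacetime O 4 d R₀ →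
          (∀ i j : Fin d.N, i ≠ j →
            ((d.motion i).1 : E4 ≃L[ℝ] E4) (E4.basisVector 0) ≠ ((d.motion j).1 : E4 ≃L[ℝ] E4) (E4.basisVector 0)) →
          0 < d.N → NeckCertificate 𝒟.toSpacetime O d R₀) →
      Theses.StarvedNecks.NecksCertifyR := by
  intro HonestCore HonestFar NeckCertificate HuygensNeckLemma KirchhoffFormula hPos
  exact NecksCertifyTwoCap.ReductionZero.necksCertify_repaired_of_neckLedgerAnalysisPos hPos

/-! ## The rev-6 cut: `NecksCertifyR` from / against its two cut items (lead c9 of stmt-17574, 2026-08-17)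

Since route rev 5/6 the crux `NecksCertifyR` (stmt-FinalStateConjecture-17574) is CUT into its physics
`NeckGapDecay` (stmt-16768) and its gauge `GapDecaySuffices := NeckGapDecay → NecksCertifyR` (stmt-18060); the
deciding theorem `Theses.StarvedNecks.closes` takes both and uses `have hS : NecksCertifyR := h₃ h₂`.  The three
one-liners below bank that cut against the ROUTE DECLS (it is also the composition `NecksCertifyR_of` of the
registered birth skeleton v2, `Cruxes/NecksCertifyR/Lines/birth.lean`): the crux from the two items, the gauge
item from the crux, and — given the physics item — their equivalence, i.e. what remains of stmt-17574 once
stmt-16768 lands is exactly stmt-18060.  Pure logic; no definitions, no named facts. -/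

/-- **The crux from its two cut items**: `NeckGapDecay → GapDecaySuffices → NecksCertifyR` — the gauge item is by
definition the implication `NeckGapDecay → NecksCertifyR` (route file rev 6), so the crux is its value at the
physics item; verbatim the step `have hS : NecksCertifyR := h₃ h₂` of `Theses.StarvedNecks.closes`. [folklore] -/
theorem necksCertifyR_of_neckGapDecay_of_gapDecaySuffices : Theses.StarvedNecks.NeckGapDecay → Theses.StarvedNecks.GapDecaySuffices → Theses.StarvedNecks.NecksCertifyR :=
  fun h₁ h₂ ↦ h₂ h₁

/-- **The crux gives the gauge item outright** (`GapDecaySuffices` is an implication whose conclusion is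
`NecksCertifyR`; its antecedent is discarded). [folklore] -/
theorem gapDecaySuffices_of_necksCertifyR (h : Theses.StarvedNecks.NecksCertifyR) :
    Theses.StarvedNecks.GapDecaySuffices :=
  fun _ ↦ h

/-- **Given the physics item, the crux and the gauge item are equivalent**: under `NeckGapDecay`,
`NecksCertifyR ↔ GapDecaySuffices`. [folklore] -/
theorem necksCertifyR_iff_gapDecaySuffices_of_neckGapDecay (h₁ : Theses.StarvedNecks.NeckGapDecay) :
    Theses.StarvedNecks.NecksCertifyR ↔ Theses.StarvedNecks.GapDecaySuffices :=
  ⟨gapDecaySuffices_of_necksCertifyR, fun h₂ ↦ h₂ h₁⟩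

end Summit.FinalStateConjecture.FinalStateConjecture.Theorems.NecksCertifyRRelations

end
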